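import Mathlib.Data.Nat.Squarefree
import Mathlib.Data.Nat.Factorization.Basic
import Mathlib.Analysis.PSeries
import Mathlib.Analysis.SpecialFunctions.Pow.Real
import Mathlib.Analysis.SpecialFunctions.Sqrt
import HarnessLib

/-!
# The powerful part of an integer: `n = k · u`, `k` squarefull, `u` squarefree, `(k, u) = 1`

Topic `Literature/NumberTheory/Sieve`.  Elementary tools (definitions with bodies, everything PROVED,
no named fact) for the classical reduction "factor each integer `n` as `n = n'k` with `μ(n')² = 1`,
`(n', k) = 1` and `k ∈ 𝒦`", `𝒦 = {k : p ∣ k ⇒ p² ∣ k}` the squarefull (powerful) numbers, used e.g. in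
S. Drappeau, Proc. LMS 114 (2017), §5.2 (arXiv:1504.05549 p. 17) after É. Fouvry, *Sur le problème
des diviseurs de Titchmarsh*, Crelle 357 (1985), §V.2, together with the count of Erdős–Szekeres
"there are only `O(K^{1/2})` squarefull numbers up to `K`, therefore `∑_{k ≥ K, k ∈ 𝒦} 1/k ≪ K^{−1/2}`".

* `PowerfulPart.exactPart n = ∏_{p ∥ n} p` (the product of the primes dividing `n` exactly once) and
  `PowerfulPart.powerfulPart n = n / exactPart n`; `powerfulPart_mul_exactPart` (`n = k u`),
  `squarefree_exactPart`, `coprime_powerfulPart_exactPart`, `sq_dvd_powerfulPart_of_dvd` (`k` is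
  squarefull), and the uniqueness `exactPart_mul_eq` / `powerfulPart_mul_eq`: if `k` is squarefull,
  `u` squarefree and `(k, u) = 1` then `exactPart (k u) = u`, `powerfulPart (k u) = k`.
* `PowerfulPart.exists_sq_mul_cube_eq` — a squarefull `k ≥ 1` is `c² a³` (Erdős–Szekeres).
* `PowerfulPart.sum_Icc_one_div_mul_sqrt_le` — `∑_{a ≤ X} a^{−3/2} ≤ 3`;
  `PowerfulPart.sum_inv_sq_filter_le` — `∑_{c ≤ X, c²a³ > K} c⁻² ≤ 2 a^{3/2} K^{−1/2}`;
  **`PowerfulPart.card_filter_lt_powerfulPart_le`** — `#{n ≤ X : powerfulPart n > K} ≤ 6 X K^{−1/2}`;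
  **`PowerfulPart.sum_filter_squarefull_le`** — for `g ≥ 0`,
  `∑_{k ≤ Z squarefull} g(k) ≤ ∑_{c ≤ Z} ∑_{a ≤ Z} g(c²a³)`, and `PowerfulPart.sum_box_le_nine` —
  `∑_{c,a ≤ Z} (ca)^{−3/2} ≤ 9` (so `∑_{k squarefull} k^{−3/4} ≤ 9`).

## References

* P. Erdős, G. Szekeres, Acta Sci. Math. (Szeged) 7 (1934) 95–102 (squarefull numbers are `a²b³`;
  `#{k ≤ x} ≪ x^{1/2}`). [folklore]
* S. Drappeau, Proc. London Math. Soc. (3) 114 (2017) 684–732, §5.2. [cite: Drappeau2017, §5.2]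
-/

noncomputable section

open Finset Real

namespace Literature.NumberTheory.Sieve

namespace PowerfulPart

/-! ### The decomposition -/

/-- `exactPart n = ∏_{p ∥ n} p`, the product of the primes dividing `n` exactly once (`= 1` for
`n = 0`). [folklore] -/
def exactPart (n : ℕ) : ℕ := (n.primeFactors.filter (fun q => n.factorization q = 1)).prod id

/-- `powerfulPart n = n / exactPart n = ∏_{p² ∣ n} p^{v_p(n)}`, the squarefull part of `n`.
[folklore] -/
def powerfulPart (n : ℕ) : ℕ := n / exactPart n

/-- `exactPart n ≠ 0`. [folklore] -/
theorem exactPart_ne_zero (n : ℕ) : exactPart n ≠ 0 :=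
  Finset.prod_ne_zero_iff.2 fun _ hp => (Nat.prime_of_mem_primeFactors (Finset.mem_filter.1 hp).1).ne_zero

/-- `exactPart n ≥ 1`. [folklore] -/
theorem exactPart_pos (n : ℕ) : 0 < exactPart n := Nat.pos_of_ne_zero (exactPart_ne_zero n)

/-- `v_q(exactPart n) = 1` if `v_q(n) = 1`, else `0`. [folklore] -/
theorem factorization_exactPart (n q : ℕ) :
    (exactPart n).factorization q = if n.factorization q = 1 then 1 else 0 := by
  unfold exactPart
  rw [Nat.factorization_prod (g := id) fun p hp =>
    (Nat.prime_of_mem_primeFactors (Finset.mem_filter.1 hp).1).ne_zero]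
  rw [Finsupp.finsetSum_apply]
  have h : ∀ p ∈ n.primeFactors.filter (fun p => n.factorization p = 1),
      ((id p).factorization : ℕ →₀ ℕ) q = if p = q then 1 else 0 := by
    intro p hp
    rw [id, (Nat.prime_of_mem_primeFactors (Finset.mem_filter.1 hp).1).factorization,
      Finsupp.single_apply]
  rw [Finset.sum_congr rfl h, Finset.sum_ite_eq']
  by_cases hq : n.factorization q = 1
  · have hqmem : q ∈ n.primeFactors.filter (fun p => n.factorization p = 1) := by
      rw [Finset.mem_filter, ← Nat.support_factorization, Finsupp.mem_support_iff]
      exact ⟨by omega, hq⟩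
    rw [if_pos hqmem, if_pos hq]
  · have hqmem : q ∉ n.primeFactors.filter (fun p => n.factorization p = 1) := fun h =>
      hq (Finset.mem_filter.1 h).2
    rw [if_neg hqmem, if_neg hq]

/-- `exactPart n ∣ n`. [folklore] -/
theorem exactPart_dvd (n : ℕ) : exactPart n ∣ n := by
  rcases eq_or_ne n 0 with rfl | hn
  · exact dvd_zero _
  rw [← Nat.factorization_le_iff_dvd (exactPart_ne_zero n) hn]
  intro q
  rw [factorization_exactPart]
  split_ifs with h <;> omega

/-- `n = powerfulPart n · exactPart n`. [folklore] -/
theorem powerfulPart_mul_exactPart (n : ℕ) : powerfulPart n * exactPart n = n :=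
  Nat.div_mul_cancel (exactPart_dvd n)

/-- `powerfulPart n ∣ n`. [folklore] -/
theorem powerfulPart_dvd (n : ℕ) : powerfulPart n ∣ n :=
  Dvd.intro _ (powerfulPart_mul_exactPart n)

/-- `powerfulPart n ≠ 0` for `n ≠ 0`. [folklore] -/
theorem powerfulPart_ne_zero {n : ℕ} (hn : n ≠ 0) : powerfulPart n ≠ 0 := by
  intro h
  have := powerfulPart_mul_exactPart n
  rw [h, zero_mul] at this
  exact hn this.symm

/-- `powerfulPart n ≥ 1` for `n ≠ 0`. [folklore] -/
theorem powerfulPart_pos {n : ℕ} (hn : n ≠ 0) : 0 < powerfulPart n :=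
  Nat.pos_of_ne_zero (powerfulPart_ne_zero hn)

/-- `v_q(powerfulPart n) = 0` if `v_q(n) = 1`, else `v_q(n)`. [folklore] -/
theorem factorization_powerfulPart (n q : ℕ) :
    (powerfulPart n).factorization q = if n.factorization q = 1 then 0 else n.factorization q := by
  unfold powerfulPart
  rw [Nat.factorization_div (exactPart_dvd n), Finsupp.coe_tsub, Pi.sub_apply, factorization_exactPart]
  split_ifs with h <;> omega

/-- `exactPart n` is squarefree. [folklore] -/
theorem squarefree_exactPart (n : ℕ) : Squarefree (exactPart n) := by
  rw [Nat.squarefree_iff_factorization_le_one (exactPart_ne_zero n)]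
  intro q
  rw [factorization_exactPart]
  split_ifs <;> omega

/-- `powerfulPart n` is squarefull: every prime factor occurs at least squared. [folklore] -/
theorem sq_dvd_powerfulPart_of_dvd {n p : ℕ} (hp : p.Prime) (hpn : p ∣ powerfulPart n) :
    p ^ 2 ∣ powerfulPart n := by
  rcases eq_or_ne n 0 with rfl | hn
  · simp [powerfulPart]
  have h0 := powerfulPart_ne_zero hn
  rw [hp.pow_dvd_iff_le_factorization h0]
  have h1 : 1 ≤ (powerfulPart n).factorization p := by
    rwa [← hp.dvd_iff_one_le_factorization h0]
  rw [factorization_powerfulPart] at h1 ⊢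
  split_ifs at h1 ⊢ with h <;> omega

/-- `(powerfulPart n, exactPart n) = 1`. [folklore] -/
theorem coprime_powerfulPart_exactPart (n : ℕ) : (powerfulPart n).Coprime (exactPart n) := by
  refine Nat.coprime_of_dvd fun q hq hqk hqe => ?_
  rcases eq_or_ne n 0 with rfl | hn
  · simp [exactPart] at hqe; exact hq.ne_one hqe
  have h1 : 1 ≤ (exactPart n).factorization q := by
    rwa [← hq.dvd_iff_one_le_factorization (exactPart_ne_zero n)]
  have h2 : 1 ≤ (powerfulPart n).factorization q := by
    rwa [← hq.dvd_iff_one_le_factorization (powerfulPart_ne_zero hn)]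
  rw [factorization_exactPart] at h1
  rw [factorization_powerfulPart] at h2
  split_ifs at h1 h2 with h <;> omega

/-- **Uniqueness of the decomposition**: if `k` is squarefull, `u` squarefree and `(k, u) = 1`, then
`exactPart (k u) = u`. [folklore] -/
theorem exactPart_mul_eq {k u : ℕ} (hk : ∀ p : ℕ, p.Prime → p ∣ k → p ^ 2 ∣ k) (hu : Squarefree u)
    (hku : k.Coprime u) : exactPart (k * u) = u := by
  have hu0 : u ≠ 0 := hu.ne_zero
  rcases eq_or_ne k 0 with rfl | hk0
  · have : u = 1 := by simpa using hku
    subst this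
    simp [exactPart]
  refine Nat.eq_of_factorization_eq (exactPart_ne_zero _) hu0 fun q => ?_
  rw [factorization_exactPart, Nat.factorization_mul hk0 hu0, Finsupp.coe_add, Pi.add_apply]
  have hu1 : u.factorization q ≤ 1 := (Nat.squarefree_iff_factorization_le_one hu0).1 hu q
  by_cases hq : q.Prime
  swap
  · simp [Nat.factorization_eq_zero_of_not_prime _ hq]
  -- `v_q(k) ≠ 1`, and `v_q(k)`, `v_q(u)` are not both positive
  have hk1 : k.factorization q ≠ 1 := by
    intro h1
    have hqk : q ∣ k := (hq.dvd_iff_one_le_factorization hk0).2 h1.ge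
    have h2 := (hq.pow_dvd_iff_le_factorization hk0).1 (hk q hq hqk)
    omega
  have hdisj : k.factorization q = 0 ∨ u.factorization q = 0 := by
    rcases Nat.eq_zero_or_pos (k.factorization q) with h1 | h1
    · exact Or.inl h1
    rcases Nat.eq_zero_or_pos (u.factorization q) with h2 | h2
    · exact Or.inr h2
    have hqk : q ∣ k := (hq.dvd_iff_one_le_factorization hk0).2 h1
    have hqu : q ∣ u := (hq.dvd_iff_one_le_factorization hu0).2 h2
    exact absurd ((Nat.coprime_iff_gcd_eq_one.1 hku) ▸ Nat.dvd_gcd hqk hqu |> Nat.dvd_one.1)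
      hq.ne_one
  rcases hdisj with h | h
  · rw [h, zero_add]
    split_ifs with h' <;> omega
  · rw [h, add_zero]
    split_ifs with h' <;> omega

/-- If `k` is squarefull, `u` squarefree and `(k, u) = 1`, then `powerfulPart (k u) = k`. [folklore] -/
theorem powerfulPart_mul_eq {k u : ℕ} (hk : ∀ p : ℕ, p.Prime → p ∣ k → p ^ 2 ∣ k) (hu : Squarefree u)
    (hku : k.Coprime u) : powerfulPart (k * u) = k := by
  unfold powerfulPart
  rw [exactPart_mul_eq hk hu hku, Nat.mul_div_cancel _ (Nat.pos_of_ne_zero hu.ne_zero)]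

/-! ### Squarefull numbers are `c² a³` -/

/-- **Erdős–Szekeres**: a squarefull `k ≥ 1` can be written `k = c² a³`. [folklore] -/
theorem exists_sq_mul_cube_eq {k : ℕ} (hk0 : 0 < k) (hk : ∀ p : ℕ, p.Prime → p ∣ k → p ^ 2 ∣ k) :
    ∃ c a : ℕ, 0 < c ∧ 0 < a ∧ c ^ 2 * a ^ 3 = k := by
  obtain ⟨a, b, ha, hb, hab, hsq⟩ := Nat.sq_mul_squarefree_of_pos hk0
  -- every prime factor of `a` divides `b`
  have hdvd : a ∣ b := by
    rw [← Nat.prod_primeFactors_of_squarefree hsq, Nat.prod_primeFactors_dvd_iff hb.ne']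
    intro p hp
    have hp' := Nat.prime_of_mem_primeFactors hp
    have hpa : p ∣ a := Nat.dvd_of_mem_primeFactors hp
    rw [Nat.mem_primeFactors_of_ne_zero hb.ne']
    refine ⟨hp', ?_⟩
    by_contra hpb
    have h1 : p ^ 2 ∣ k := hk p hp' (hab ▸ dvd_mul_of_dvd_right hpa _)
    rw [← hab] at h1
    have hcop : (p ^ 2).Coprime (b ^ 2) :=
      Nat.Coprime.pow 2 2 ((Nat.Prime.coprime_iff_not_dvd hp').2 hpb)
    have h2 : p ^ 2 ∣ a := hcop.dvd_of_dvd_mul_left h1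
    have h3 : p * p ∣ a := by simpa [pow_two] using h2
    exact hp'.not_isUnit (hsq p h3)
  obtain ⟨c, rfl⟩ := hdvd
  refine ⟨c, a, Nat.pos_of_mul_pos_left hb, ha, ?_⟩
  rw [← hab]; ring

/-! ### Sums and counts -/

/-- `∑_{a=1}^{X} 1/(a√a) ≤ 3` (compare `a^{−3/2} ≤ 2((a−1)^{−1/2} − a^{−1/2})`). [folklore] -/
theorem sum_Icc_one_div_mul_sqrt_le (X : ℕ) :
    ∑ a ∈ Icc 1 X, 1 / ((a : ℝ) * Real.sqrt a) ≤ 3 := by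
  -- telescoping bound for `a ≥ 2`
  have hstep : ∀ a : ℕ, 2 ≤ a →
      1 / ((a : ℝ) * Real.sqrt a) ≤ 2 * (1 / Real.sqrt (a - 1 : ℕ) - 1 / Real.sqrt a) := by
    intro a ha
    have ha1 : (1 : ℝ) ≤ ((a - 1 : ℕ) : ℝ) := by
      have : 1 ≤ a - 1 := by omega
      exact_mod_cast this
    have ha' : ((a - 1 : ℕ) : ℝ) = (a : ℝ) - 1 := by
      rw [Nat.cast_sub (by omega)]; simp
    have hapos : (0 : ℝ) < a := by positivity
    set s := Real.sqrt a with hs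
    set t := Real.sqrt ((a - 1 : ℕ) : ℝ) with ht
    have hs0 : 0 < s := Real.sqrt_pos.2 hapos
    have ht0 : 0 < t := Real.sqrt_pos.2 (by linarith)
    have hs2 : s ^ 2 = a := Real.sq_sqrt hapos.le
    have ht2 : t ^ 2 = (a : ℝ) - 1 := by rw [ht, Real.sq_sqrt (by linarith), ha']
    have hts : t ≤ s := Real.sqrt_le_sqrt (by linarith)
    -- `1/(a s) ≤ 2 (1/t − 1/s)` ⟸ `t s ≤ 2 a (s − t)`... use `s − t = 1/(s + t)`
    rw [div_sub_div _ _ ht0.ne' hs0.ne', div_le_iff₀ (mul_pos hapos hs0),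
      show 2 * ((1 * s - t * 1) / (t * s)) * ((a : ℝ) * s) = 2 * (s - t) * (a : ℝ) / t by
        field_simp]
    rw [le_div_iff₀ ht0]
    have hst : (s - t) * (s + t) = 1 := by nlinarith
    have hspt : 0 < s + t := by linarith
    have hsmt : s - t = 1 / (s + t) := by
      field_simp; linarith
    rw [hsmt]
    rw [show 2 * (1 / (s + t)) * (a : ℝ) = 2 * a / (s + t) by ring, le_div_iff₀ hspt]
    -- `t (s + t) ≤ 2 a`: `t s ≤ s² = a` and `t² = a − 1 ≤ a`
    nlinarith
  -- sum, for `X ≥ 1`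
  have hsum : ∀ X : ℕ, 1 ≤ X → ∑ a ∈ Icc 1 X, 1 / ((a : ℝ) * Real.sqrt a) ≤
      3 - 2 * (1 / Real.sqrt (X : ℕ)) := by
    intro X hX
    induction X, hX using Nat.le_induction with
    | base => simp; norm_num
    | succ n hn ih =>
      rw [Finset.sum_Icc_succ_top (by omega)]
      have hst := hstep (n + 1) (by omega)
      have : ((n + 1 - 1 : ℕ) : ℝ) = (n : ℕ) := by simp
      rw [this] at hst
      linarith
  rcases Nat.eq_zero_or_pos X with rfl | hX
  · simp
  refine (hsum X hX).trans ?_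
  have : 0 ≤ 1 / Real.sqrt (X : ℕ) := by positivity
  linarith

/-- For `a ≥ 1`, `K > 0`: `∑_{1 ≤ c ≤ X, c² a³ > K} 1/c² ≤ 2 a√a / √K` (the `c` exceed `√(K/a³)`, and
`∑_{c > W} c⁻² ≤ 2/(⌊W⌋ + 1)`). [folklore] -/
theorem sum_inv_sq_filter_le (X : ℕ) {a : ℕ} (ha : 0 < a) {K : ℝ} (hK : 0 < K) :
    ∑ c ∈ (Icc 1 X).filter (fun c : ℕ => K < (c : ℝ) ^ 2 * (a : ℝ) ^ 3), ((c : ℝ) ^ 2)⁻¹ ≤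
      2 * ((a : ℝ) * Real.sqrt a) / Real.sqrt K := by
  have ha' : (0 : ℝ) < a := by exact_mod_cast ha
  set W : ℝ := Real.sqrt K / ((a : ℝ) * Real.sqrt a) with hW
  have hasq : 0 < (a : ℝ) * Real.sqrt a := mul_pos ha' (Real.sqrt_pos.2 ha')
  have hW0 : 0 < W := div_pos (Real.sqrt_pos.2 hK) hasq
  have hW2 : W ^ 2 = K / (a : ℝ) ^ 3 := by
    rw [hW, div_pow, Real.sq_sqrt hK.le, mul_pow, Real.sq_sqrt ha'.le]; ring
  have hsub : (Icc 1 X).filter (fun c : ℕ => K < (c : ℝ) ^ 2 * (a : ℝ) ^ 3) ⊆ Ioo ⌊W⌋₊ (X + 1) := by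
    intro c hc
    rw [Finset.mem_filter, Finset.mem_Icc] at hc
    rw [Finset.mem_Ioo]
    refine ⟨?_, Nat.lt_succ_of_le hc.1.2⟩
    have hc2 : W ^ 2 < (c : ℝ) ^ 2 := by
      rw [hW2, div_lt_iff₀ (by positivity)]; exact hc.2
    have hcW : W < c := by
      by_contra h
      have : (c : ℝ) ^ 2 ≤ W ^ 2 := pow_le_pow_left₀ (Nat.cast_nonneg c) (not_lt.1 h) 2
      linarith
    exact (Nat.floor_lt hW0.le).2 hcW
  calc ∑ c ∈ (Icc 1 X).filter (fun c : ℕ => K < (c : ℝ) ^ 2 * (a : ℝ) ^ 3), ((c : ℝ) ^ 2)⁻¹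
      ≤ ∑ c ∈ Ioo ⌊W⌋₊ (X + 1), ((c : ℝ) ^ 2)⁻¹ :=
        Finset.sum_le_sum_of_subset_of_nonneg hsub fun _ _ _ => by positivity
    _ ≤ 2 / ((⌊W⌋₊ : ℝ) + 1) := sum_Ioo_inv_sq_le _ _
    _ ≤ 2 / W := div_le_div_of_nonneg_left (by norm_num) hW0 (Nat.lt_floor_add_one W).le
    _ = 2 * ((a : ℝ) * Real.sqrt a) / Real.sqrt K := by
        rw [hW]; field_simp

/-- **Integers with a large squarefull part are rare**: for `K > 0`,
`#{1 ≤ n ≤ X : powerfulPart n > K} ≤ 6 X / √K` (each such `n` is divisible by some `c²a³ > K`; there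
are `≤ X/(c²a³)` multiples, and `∑_{c²a³ > K} 1/(c²a³) ≤ 6/√K`). [folklore] -/
theorem card_filter_lt_powerfulPart_le (X : ℕ) {K : ℝ} (hK : 0 < K) :
    ((#((Icc 1 X).filter (fun n : ℕ => K < (powerfulPart n : ℝ))) : ℝ)) ≤ 6 * X / Real.sqrt K := by
  set B := (Icc 1 X) ×ˢ (Icc 1 X) with hB
  set good : ℕ × ℕ → Prop := fun q => K < ((q.1 : ℝ)) ^ 2 * ((q.2 : ℝ)) ^ 3 with hgood
  -- cover by the multiples of `c² a³`
  have hcover : (Icc 1 X).filter (fun n : ℕ => K < (powerfulPart n : ℝ)) ⊆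
      (B.filter good).biUnion (fun q => (Icc 1 X).filter (fun n => q.1 ^ 2 * q.2 ^ 3 ∣ n)) := by
    intro n hn
    rw [Finset.mem_filter, Finset.mem_Icc] at hn
    have hn0 : n ≠ 0 := by omega
    obtain ⟨c, a, hc, ha, hca⟩ := exists_sq_mul_cube_eq (powerfulPart_pos hn0)
      (fun p hp hpd => sq_dvd_powerfulPart_of_dvd hp hpd)
    have hdvd : c ^ 2 * a ^ 3 ∣ n := hca ▸ powerfulPart_dvd n
    have hle : c ^ 2 * a ^ 3 ≤ n := Nat.le_of_dvd (by omega) hdvd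
    have hc1 : c ≤ c ^ 2 * a ^ 3 := by
      calc c = c * 1 := (mul_one c).symm
        _ ≤ c ^ 2 * a ^ 3 := by
          rw [pow_two, mul_assoc]
          exact Nat.mul_le_mul_left c (Nat.one_le_iff_ne_zero.2 (by positivity))
    have ha1 : a ≤ c ^ 2 * a ^ 3 := by
      calc a = 1 * (a * 1) := by ring
        _ ≤ c ^ 2 * (a * a ^ 2) :=
          Nat.mul_le_mul (Nat.one_le_iff_ne_zero.2 (by positivity))
            (Nat.mul_le_mul_left a (Nat.one_le_iff_ne_zero.2 (by positivity)))
        _ = c ^ 2 * a ^ 3 := by ring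
    rw [Finset.mem_biUnion]
    refine ⟨(c, a), ?_, ?_⟩
    · rw [Finset.mem_filter, hB, Finset.mem_product, Finset.mem_Icc, Finset.mem_Icc]
      refine ⟨⟨⟨hc, by omega⟩, ⟨ha, by omega⟩⟩, ?_⟩
      show K < (c : ℝ) ^ 2 * (a : ℝ) ^ 3
      have : ((c ^ 2 * a ^ 3 : ℕ) : ℝ) = (c : ℝ) ^ 2 * (a : ℝ) ^ 3 := by push_cast; ring
      rw [← this, hca]; exact hn.2
    · rw [Finset.mem_filter, Finset.mem_Icc]
      exact ⟨hn.1, hdvd⟩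
  -- count
  have hcount : ∀ q ∈ B.filter good,
      ((#((Icc 1 X).filter (fun n => q.1 ^ 2 * q.2 ^ 3 ∣ n)) : ℝ)) ≤
        (X : ℝ) / ((q.1 : ℝ) ^ 2 * (q.2 : ℝ) ^ 3) := by
    intro q hq
    rw [Finset.mem_filter, hB, Finset.mem_product, Finset.mem_Icc, Finset.mem_Icc] at hq
    have hd0 : 0 < q.1 ^ 2 * q.2 ^ 3 := by
      have := hq.1.1.1; have := hq.1.2.1; positivity
    have h1 : #((Icc 1 X).filter (fun n => q.1 ^ 2 * q.2 ^ 3 ∣ n)) = X / (q.1 ^ 2 * q.2 ^ 3) := by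
      rw [show Icc 1 X = Ioc 0 X from rfl]
      exact Nat.Ioc_filter_dvd_card_eq_div X (q.1 ^ 2 * q.2 ^ 3)
    rw [h1]
    have h2 : (((X / (q.1 ^ 2 * q.2 ^ 3) : ℕ) : ℝ)) ≤ (X : ℝ) / ((q.1 ^ 2 * q.2 ^ 3 : ℕ) : ℝ) :=
      Nat.cast_div_le
    refine h2.trans (le_of_eq ?_)
    push_cast; ring
  calc ((#((Icc 1 X).filter (fun n : ℕ => K < (powerfulPart n : ℝ))) : ℝ))
      ≤ #((B.filter good).biUnion (fun q => (Icc 1 X).filter (fun n => q.1 ^ 2 * q.2 ^ 3 ∣ n))) := by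
        exact_mod_cast Finset.card_le_card hcover
    _ ≤ ∑ q ∈ B.filter good, ((#((Icc 1 X).filter (fun n => q.1 ^ 2 * q.2 ^ 3 ∣ n)) : ℝ)) := by
        exact_mod_cast Finset.card_biUnion_le
    _ ≤ ∑ q ∈ B.filter good, (X : ℝ) / ((q.1 : ℝ) ^ 2 * (q.2 : ℝ) ^ 3) := Finset.sum_le_sum hcount
    _ = ∑ a ∈ Icc 1 X, ∑ c ∈ (Icc 1 X).filter (fun c : ℕ => K < (c : ℝ) ^ 2 * (a : ℝ) ^ 3),
          (X : ℝ) * ((a : ℝ) ^ 3)⁻¹ * ((c : ℝ) ^ 2)⁻¹ := by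
        rw [Finset.sum_filter, hB, Finset.sum_product_right]
        refine Finset.sum_congr rfl fun a _ => ?_
        rw [Finset.sum_filter]
        refine Finset.sum_congr rfl fun c _ => ?_
        split_ifs
        · rw [div_eq_mul_inv, mul_inv]; ring
        · rfl
    _ ≤ ∑ a ∈ Icc 1 X, (X : ℝ) * ((a : ℝ) ^ 3)⁻¹ * (2 * ((a : ℝ) * Real.sqrt a) / Real.sqrt K) := by
        refine Finset.sum_le_sum fun a ha => ?_
        rw [← Finset.mul_sum]
        have ha0 : 0 < a := (Finset.mem_Icc.1 ha).1
        exact mul_le_mul_of_nonneg_left (sum_inv_sq_filter_le X ha0 hK) (by positivity)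
    _ = (2 * X / Real.sqrt K) * ∑ a ∈ Icc 1 X, 1 / ((a : ℝ) * Real.sqrt a) := by
        rw [Finset.mul_sum]
        refine Finset.sum_congr rfl fun a ha => ?_
        have ha0 : (0 : ℝ) < a := by exact_mod_cast (Finset.mem_Icc.1 ha).1
        have hsa : 0 < Real.sqrt a := Real.sqrt_pos.2 ha0
        have h3 : (a : ℝ) ^ 3 = ((a : ℝ) * Real.sqrt a) * ((a : ℝ) * Real.sqrt a) := by
          have := Real.mul_self_sqrt ha0.le
          calc (a : ℝ) ^ 3 = a * a * (Real.sqrt a * Real.sqrt a) := by rw [this]; ring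
            _ = _ := by ring
        rw [h3]
        field_simp
    _ ≤ (2 * X / Real.sqrt K) * 3 :=
        mul_le_mul_of_nonneg_left (sum_Icc_one_div_mul_sqrt_le X) (by positivity)
    _ = 6 * X / Real.sqrt K := by ring

/-- **Summing over squarefull numbers through `k = c²a³`**: for `g ≥ 0`,
`∑_{1 ≤ k ≤ Z, k squarefull} g(k) ≤ ∑_{c ≤ Z} ∑_{a ≤ Z} g(c² a³)`. [folklore] -/
theorem sum_filter_squarefull_le (Z : ℕ) {g : ℕ → ℝ} (hg : ∀ k, 0 ≤ g k) :
    ∑ k ∈ (Icc 1 Z).filter (fun k : ℕ => ∀ p ∈ k.primeFactors, p ^ 2 ∣ k), g k ≤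
      ∑ c ∈ Icc 1 Z, ∑ a ∈ Icc 1 Z, g (c ^ 2 * a ^ 3) := by
  set P := (Icc 1 Z).filter (fun k : ℕ => ∀ p ∈ k.primeFactors, p ^ 2 ∣ k) with hP
  -- a choice of `(c, a)` for each squarefull `k`
  have hex : ∀ k ∈ P, ∃ q : ℕ × ℕ, q ∈ (Icc 1 Z) ×ˢ (Icc 1 Z) ∧ q.1 ^ 2 * q.2 ^ 3 = k := by
    intro k hk
    rw [hP, Finset.mem_filter, Finset.mem_Icc] at hk
    obtain ⟨c, a, hc, ha, hca⟩ := exists_sq_mul_cube_eq (k := k) (by omega)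
      (fun p hp hpk => hk.2 p ((Nat.mem_primeFactors_of_ne_zero (by omega)).2 ⟨hp, hpk⟩))
    have hle : c ^ 2 * a ^ 3 ≤ Z := hca ▸ hk.1.2
    refine ⟨(c, a), ?_, hca⟩
    rw [Finset.mem_product, Finset.mem_Icc, Finset.mem_Icc]
    refine ⟨⟨hc, ?_⟩, ⟨ha, ?_⟩⟩
    · calc c = c * 1 := (mul_one c).symm
        _ ≤ c ^ 2 * a ^ 3 := by
          rw [pow_two, mul_assoc]
          exact Nat.mul_le_mul_left c (Nat.one_le_iff_ne_zero.2 (by positivity))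
        _ ≤ Z := hle
    · calc a = 1 * (a * 1) := by ring
        _ ≤ c ^ 2 * (a * a ^ 2) :=
          Nat.mul_le_mul (Nat.one_le_iff_ne_zero.2 (by positivity))
            (Nat.mul_le_mul_left a (Nat.one_le_iff_ne_zero.2 (by positivity)))
        _ = c ^ 2 * a ^ 3 := by ring
        _ ≤ Z := hle
  choose! φ hφ using hex
  have hinj : Set.InjOn φ P := by
    intro k hk k' hk' h
    rw [← (hφ k hk).2, ← (hφ k' hk').2, h]
  calc ∑ k ∈ P, g k = ∑ k ∈ P, g ((φ k).1 ^ 2 * (φ k).2 ^ 3) :=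
        Finset.sum_congr rfl fun k hk => by rw [(hφ k hk).2]
    _ = ∑ q ∈ P.image φ, g (q.1 ^ 2 * q.2 ^ 3) := by
        rw [Finset.sum_image hinj]
    _ ≤ ∑ q ∈ (Icc 1 Z) ×ˢ (Icc 1 Z), g (q.1 ^ 2 * q.2 ^ 3) :=
        Finset.sum_le_sum_of_subset_of_nonneg
          (fun q hq => by
            obtain ⟨k, hk, rfl⟩ := Finset.mem_image.1 hq
            exact (hφ k hk).1)
          fun _ _ _ => hg _
    _ = ∑ c ∈ Icc 1 Z, ∑ a ∈ Icc 1 Z, g (c ^ 2 * a ^ 3) := Finset.sum_product _ _ _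

/-- `∑_{c ≤ Z} ∑_{a ≤ Z} 1/((c√c)(a√a)) ≤ 9`. [folklore] -/
theorem sum_box_le_nine (Z : ℕ) :
    ∑ c ∈ Icc 1 Z, ∑ a ∈ Icc 1 Z, 1 / (((c : ℝ) * Real.sqrt c) * ((a : ℝ) * Real.sqrt a)) ≤ 9 := by
  have h := sum_Icc_one_div_mul_sqrt_le Z
  have h0 : 0 ≤ ∑ a ∈ Icc 1 Z, 1 / ((a : ℝ) * Real.sqrt a) :=
    Finset.sum_nonneg fun a _ => by positivity
  calc ∑ c ∈ Icc 1 Z, ∑ a ∈ Icc 1 Z, 1 / (((c : ℝ) * Real.sqrt c) * ((a : ℝ) * Real.sqrt a))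
      = (∑ c ∈ Icc 1 Z, 1 / ((c : ℝ) * Real.sqrt c)) * ∑ a ∈ Icc 1 Z, 1 / ((a : ℝ) * Real.sqrt a) := by
        rw [Finset.sum_mul_sum]
        refine Finset.sum_congr rfl fun c _ => Finset.sum_congr rfl fun a _ => ?_
        rw [one_div_mul_one_div]
    _ ≤ 3 * 3 := mul_le_mul h h h0 (by norm_num)
    _ = 9 := by norm_num

/-- `(c² a³)^{3/4} ≥ (c√c)(a√a)` for `c, a ≥ 1`, in the form
`((c²a³ : ℝ))^{-(3/4)} ≤ 1/((c√c)(a√a))`. [folklore] -/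
theorem rpow_neg_three_quarters_le {c a : ℕ} (hc : 0 < c) (ha : 0 < a) :
    (((c ^ 2 * a ^ 3 : ℕ) : ℝ)) ^ (-(3 / 4 : ℝ)) ≤ 1 / (((c : ℝ) * Real.sqrt c) * ((a : ℝ) * Real.sqrt a)) := by
  have hc' : (0 : ℝ) < c := by exact_mod_cast hc
  have ha' : (0 : ℝ) < a := by exact_mod_cast ha
  have hca : ((c : ℝ) * a) ^ 2 ≤ ((c ^ 2 * a ^ 3 : ℕ) : ℝ) := by
    push_cast
    have ha1 : (1 : ℝ) ≤ a := by exact_mod_cast ha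
    nlinarith [mul_pos hc' ha', sq_nonneg ((c : ℝ) * a)]
  have hpos : (0 : ℝ) < ((c ^ 2 * a ^ 3 : ℕ) : ℝ) := by positivity
  -- `(c a)^{3/2} = (c√c)(a√a)` and `k^{3/4} ≥ ((ca)²)^{3/4} = (ca)^{3/2}`
  have h1 : (((c : ℝ) * a) ^ 2) ^ (3 / 4 : ℝ) ≤ (((c ^ 2 * a ^ 3 : ℕ) : ℝ)) ^ (3 / 4 : ℝ) :=
    Real.rpow_le_rpow (by positivity) hca (by norm_num)
  have h2 : (((c : ℝ) * a) ^ 2) ^ (3 / 4 : ℝ) = ((c : ℝ) * Real.sqrt c) * ((a : ℝ) * Real.sqrt a) := by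
    rw [← Real.rpow_natCast, ← Real.rpow_mul (by positivity)]
    norm_num
    rw [show (3 / 2 : ℝ) = 1 + 1 / 2 by norm_num, Real.rpow_add (by positivity), Real.rpow_one,
      Real.mul_rpow hc'.le ha'.le, ← Real.sqrt_eq_rpow, ← Real.sqrt_eq_rpow]
    ring
  rw [Real.rpow_neg hpos.le, one_div]
  rw [inv_le_inv₀ (Real.rpow_pos_of_pos hpos _) (by positivity)]
  rw [← h2]; exact h1

end PowerfulPart

end Literature.NumberTheory.Sieve

end
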